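/-
Origin: expansion seat `planner-pub-hodgecm-pv06-g2-0`, handover 2026-08-18T05:05:56Z (`HOME/pub-hodgecm-pv06-g2/lean/Pv06g2/QuotientSmoothingHaar.lean`, md5 805c04ca, 222 lines);
landed by the gen-6 packager in gate run 22 as `HodgeCM/PerL34/QuotientSmoothingHaar.lean` (import ^import Pv[0-9]+g[0-9]+\.→import HodgeCM.PerL34. ×1).
-/
/-
Origin: HOME/pub-hodgecm-pv06-g2/lean/Pv06g2/QuotientSmoothingHaar.lean — session planner-pub-hodgecm-pv06-g2-0 (unit
pub-hodgecm-pv06-g2, DAG-NODE PROVER #06 of 15, generation 2).  Intended final place: `HodgeCM/PerL34/QuotientSmoothingHaar.lean`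
(namespace `HodgeCM.PerL34.QuotientSmoothing`).  WIP import `Pv06g2.QuotientSmoothing` ↦ `HodgeCM.PerL34.QuotientSmoothing`.
Closed, nothing cited, nothing posited.

# The standing instance hypotheses of `QuotientSmoothing.sm_cont_model`, discharged for Haar measure

`QuotientSmoothing.sm_cont_model` (node N23c, `[SETUP D7] sm_cont`) is stated for a measure `ν` on `X = G ⧸ Γ` carrying
the instances `SMulInvariantMeasure G X ν`, `IsFiniteMeasure ν`, `ν.InnerRegularCompactLTTop`, for `μ` on `G` carrying
`IsMulLeftInvariant`, `IsMulRightInvariant`, `IsInvInvariant`, and for `hν : ν = map π (μ|𝓕)`.  Here every one of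
these is DERIVED from: `μ` a regular Haar measure on the unimodular group `G` (`[IsHaarMeasure μ] [μ.Regular]
[μ.IsMulRightInvariant]`), `𝓕` a measurable fundamental domain for `Γ` (acting on the right) of finite measure, `Γ`
discrete, countable and closed with `G ⧸ Γ` compact:

* `isInvInvariant_of_isMulRightInvariant` — a regular left Haar measure which is also right invariant is inversion
  invariant (Mathlib has this for abelian groups only, `IsHaarMeasure.isInvInvariant_of_regular`; same proof);
* `smulInvariantMeasure_map_restrict` — `ν = map π (μ|𝓕)` is `G`-invariant (Mathlib's
  `QuotientMeasureEqMeasurePreimage.smulInvariantMeasure_quotient` assumes `PolishSpace G`; direct proof here from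
  `IsFundamentalDomain.measure_set_eq`, no Polish hypothesis);
* `isFiniteMeasure_map_restrict`, `innerRegularCompactLTTop_map_restrict` — from `μ 𝓕 ≠ ⊤`, resp. regularity of `μ`;
* `exists_isCompact_image_mk_eq_univ`, `measure_fundamentalDomain_lt_top` — cocompact ⇒ finite covolume;
* `sm_cont_haar` — `sm_cont_model` with all of the above supplied; `sm_cont_haar'` — without the `μ 𝓕 ≠ ⊤` input.
-/
import Summits.HodgeConjecture.HodgeCM.PerL34.QuotientSmoothing_2

/-! PORT of `HodgeCM/PerL34/QuotientSmoothingHaar.lean` (HodgeCMPerL run 82) — verbatim mechanical port; provenance in the PORT header line. -/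

set_option autoImplicit false

noncomputable section

open MeasureTheory MeasureTheory.Measure Set Filter Topology
open scoped ENNReal NNReal Pointwise

namespace HodgeCM
namespace PerL34
namespace QuotientSmoothing

attribute [-instance] Quotient.instMeasurableSpace

section Unimodular

variable {G : Type*} [Group G] [TopologicalSpace G] [IsTopologicalGroup G] [LocallyCompactSpace G]
  [MeasurableSpace G] [BorelSpace G] (μ : Measure G) [IsHaarMeasure μ]

/-- A regular left Haar measure on a unimodular group (i.e. one which is also right invariant) is invariant under
`g ↦ g⁻¹`.  (Proof as in Mathlib's abelian `IsHaarMeasure.isInvInvariant_of_regular`: `μ.inv` is left invariant, hence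
`c • μ`; inverting twice gives `c² = 1`.) -/
theorem isInvInvariant_of_isMulRightInvariant [μ.Regular] [μ.IsMulRightInvariant] : μ.IsInvInvariant := by
  constructor
  let c : ℝ≥0∞ := haarScalarFactor μ.inv μ
  have hc : μ.inv = c • μ := isMulLeftInvariant_eq_smul_of_regular μ.inv μ
  have : map Inv.inv (map Inv.inv μ) = c ^ 2 • μ := by
    rw [← inv_def μ, hc, Measure.map_smul, ← inv_def μ, hc, smul_smul, pow_two]
  have μeq : μ = c ^ 2 • μ := by
    rw [map_map continuous_inv.measurable continuous_inv.measurable] at this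
    simpa only [inv_involutive, Function.Involutive.comp_self, Measure.map_id]
  have K : TopologicalSpace.PositiveCompacts G := Classical.arbitrary _
  have : c ^ 2 * μ K = 1 ^ 2 * μ K := by
    conv_rhs => rw [μeq]
    simp
  have : c ^ 2 = 1 ^ 2 :=
    (ENNReal.mul_left_inj (measure_pos_of_nonempty_interior _ K.interior_nonempty).ne'
          K.isCompact.measure_lt_top.ne).1 this
  have : c = 1 := (ENNReal.pow_right_strictMono two_ne_zero).injective this
  rw [hc, this, one_smul]

end Unimodular

section QuotientMeasure

variable {G : Type*} [Group G] [TopologicalSpace G] [IsTopologicalGroup G]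
  [MeasurableSpace G] [BorelSpace G] {Γ : Subgroup G}
  [MeasurableSpace (G ⧸ Γ)] [BorelSpace (G ⧸ Γ)] (μ : Measure G)

/-- `ν = map π (μ|𝓕)` is a `G`-invariant measure on `G ⧸ Γ` when `μ` is left invariant and `𝓕` is a fundamental
domain for the right action of `Γ`.  (No `PolishSpace` hypothesis, unlike Mathlib's quotient-measure API.) -/
theorem smulInvariantMeasure_map_restrict [Countable Γ] [μ.IsMulLeftInvariant] [μ.IsMulRightInvariant] {𝓕 : Set G}
    (h𝓕 : IsFundamentalDomain Γ.op 𝓕 μ) :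
    SMulInvariantMeasure G (G ⧸ Γ) (Measure.map (QuotientGroup.mk : G → G ⧸ Γ) (μ.restrict 𝓕)) := by
  have meas_π : Measurable (QuotientGroup.mk : G → G ⧸ Γ) := continuous_quotient_mk'.measurable
  refine ⟨fun g A hA => ?_⟩
  have hgA : MeasurableSet ((fun x : G ⧸ Γ => g • x) ⁻¹' A) := measurable_const_smul g hA
  rw [Measure.map_apply meas_π hgA, Measure.map_apply meas_π hA, Measure.restrict_apply (meas_π hgA),
    Measure.restrict_apply (meas_π hA)]
  set E : Set G := QuotientGroup.mk ⁻¹' A with hE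
  have hEm : MeasurableSet E := meas_π hA
  -- `π ⁻¹' (g • ·)⁻¹' A = (g • ·)⁻¹' E`
  have h1 : (QuotientGroup.mk : G → G ⧸ Γ) ⁻¹' ((fun x : G ⧸ Γ => g • x) ⁻¹' A) = (fun x : G => g • x) ⁻¹' E := by
    ext x; simp [hE]
  -- `E` is invariant under the right action of `Γ`
  have hEinv : ∀ γ : Γ.op, (fun x : G => γ • x) ⁻¹' E = E := by
    intro γ
    ext x
    simp only [hE, mem_preimage]
    have hγ : (MulOpposite.unop (γ : Gᵐᵒᵖ)) ∈ Γ := Subgroup.mem_op.mp γ.2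
    change (QuotientGroup.mk (x * MulOpposite.unop (γ : Gᵐᵒᵖ)) : G ⧸ Γ) ∈ A ↔ _
    rw [QuotientGroup.mk_mul_of_mem x hγ]
  -- `g • 𝓕` is again a fundamental domain (left and right multiplication commute)
  have h𝓕g : IsFundamentalDomain Γ.op (g • 𝓕) μ := h𝓕.smul_of_comm g
  have h2 : (fun x : G => g • x) ⁻¹' E ∩ 𝓕 = (fun x : G => g • x) ⁻¹' (E ∩ g • 𝓕) := by
    ext x
    simp only [mem_inter_iff, mem_preimage, smul_mem_smul_set_iff]
  rw [h1, h2, measure_preimage_smul μ g, h𝓕g.measure_set_eq h𝓕 hEm hEinv]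

omit [TopologicalSpace G] [IsTopologicalGroup G] [BorelSpace G] [BorelSpace (G ⧸ Γ)] in
/-- `ν = map π (μ|𝓕)` is finite when `μ 𝓕 ≠ ⊤`. -/
theorem isFiniteMeasure_map_restrict {𝓕 : Set G} (hfin : μ 𝓕 ≠ ⊤) :
    IsFiniteMeasure (Measure.map (QuotientGroup.mk : G → G ⧸ Γ) (μ.restrict 𝓕)) :=
  haveI : IsFiniteMeasure (μ.restrict 𝓕) := isFiniteMeasure_restrict.mpr hfin
  Measure.isFiniteMeasure_map _ _

omit [IsTopologicalGroup G] in
/-- `ν = map π (μ|𝓕)` is inner regular for finite-measure sets w.r.t. compact sets when `μ` is. -/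
theorem innerRegularCompactLTTop_map_restrict [μ.InnerRegularCompactLTTop] (𝓕 : Set G) :
    (Measure.map (QuotientGroup.mk : G → G ⧸ Γ) (μ.restrict 𝓕)).InnerRegularCompactLTTop :=
  InnerRegularCompactLTTop.map_of_continuous continuous_quotient_mk'

end QuotientMeasure

section Covolume

variable {G : Type*} [Group G] [TopologicalSpace G] [IsTopologicalGroup G] [LocallyCompactSpace G]
  [MeasurableSpace G] [BorelSpace G] {Γ : Subgroup G}

omit [MeasurableSpace G] [BorelSpace G] in
/-- If `G ⧸ Γ` is compact (and `G` locally compact), some compact `K ⊆ G` maps onto `G ⧸ Γ`. -/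
theorem exists_isCompact_image_mk_eq_univ [CompactSpace (G ⧸ Γ)] :
    ∃ K : Set G, IsCompact K ∧ (QuotientGroup.mk : G → G ⧸ Γ) '' K = univ := by
  classical
  -- open cover of `G ⧸ Γ` by images of interiors of compact neighbourhoods
  have hcov : ∀ x : G ⧸ Γ, ∃ K : Set G, IsCompact K ∧
      x ∈ (QuotientGroup.mk : G → G ⧸ Γ) '' interior K := by
    intro x
    obtain ⟨g, rfl⟩ := QuotientGroup.mk_surjective x
    obtain ⟨K, hK, hKg⟩ := exists_compact_mem_nhds g
    exact ⟨K, hK, ⟨g, mem_interior_iff_mem_nhds.mpr hKg, rfl⟩⟩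
  choose K hK hxK using hcov
  obtain ⟨t, ht⟩ := isCompact_univ.elim_finite_subcover
    (fun x : G ⧸ Γ => (QuotientGroup.mk : G → G ⧸ Γ) '' interior (K x))
    (fun x => QuotientGroup.isOpenMap_coe _ isOpen_interior) (fun x _ => mem_iUnion.mpr ⟨x, hxK x⟩)
  refine ⟨⋃ x ∈ t, K x, t.isCompact_biUnion fun x _ => hK x, ?_⟩
  refine eq_univ_of_univ_subset fun y hy => ?_
  obtain ⟨x, hx⟩ := mem_iUnion.mp (ht hy)
  obtain ⟨hxt, hyx⟩ := mem_iUnion.mp hx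
  obtain ⟨g, hg, rfl⟩ := hyx
  exact ⟨g, mem_biUnion hxt (interior_subset hg), rfl⟩

/-- **Cocompact ⇒ finite covolume.**  If `G ⧸ Γ` is compact, every fundamental domain for the right action of the
countable subgroup `Γ` has finite measure for any right-invariant measure finite on compact sets. -/
theorem measure_fundamentalDomain_lt_top [CompactSpace (G ⧸ Γ)] [Countable Γ] (μ : Measure G)
    [IsFiniteMeasureOnCompacts μ] [μ.IsMulRightInvariant] {𝓕 : Set G} (h𝓕 : IsFundamentalDomain Γ.op 𝓕 μ) :
    μ 𝓕 < ⊤ := by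
  obtain ⟨K, hK, hKuniv⟩ := exists_isCompact_image_mk_eq_univ (Γ := Γ)
  -- `G = K · Γ`
  have hcover : 𝓕 ⊆ ⋃ γ : Γ.op, γ • K := by
    intro x _
    have hx : (QuotientGroup.mk x : G ⧸ Γ) ∈ (QuotientGroup.mk : G → G ⧸ Γ) '' K := by rw [hKuniv]; trivial
    obtain ⟨k, hk, hkx⟩ := hx
    have hγ : k⁻¹ * x ∈ Γ := QuotientGroup.eq.mp hkx
    refine mem_iUnion.mpr ⟨⟨MulOpposite.op (k⁻¹ * x), Subgroup.mem_op.mpr (by simpa using hγ)⟩, ?_⟩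
    refine ⟨k, hk, ?_⟩
    change k * MulOpposite.unop (MulOpposite.op (k⁻¹ * x)) = x
    rw [MulOpposite.unop_op, mul_inv_cancel_left]
  calc μ 𝓕 ≤ μ (⋃ γ : Γ.op, γ • K ∩ 𝓕) := by
        refine measure_mono fun x hx => ?_
        obtain ⟨γ, hγ⟩ := mem_iUnion.mp (hcover hx)
        exact mem_iUnion.mpr ⟨γ, hγ, hx⟩
    _ ≤ ∑' γ : Γ.op, μ (γ • K ∩ 𝓕) := measure_iUnion_le _
    _ = μ K := (h𝓕.measure_eq_tsum K).symm
    _ < ⊤ := hK.measure_lt_top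

end Covolume

section Haar

variable {G : Type*} [Group G] [TopologicalSpace G] [IsTopologicalGroup G] [LocallyCompactSpace G]
  [MeasurableSpace G] [BorelSpace G] {Γ : Subgroup G} [DiscreteTopology Γ] [Countable Γ]
  (hΓ : IsClosed (Γ : Set G))
  [MeasurableSpace (G ⧸ Γ)] [BorelSpace (G ⧸ Γ)] [CompactSpace (G ⧸ Γ)]
  (μ : Measure G) [IsHaarMeasure μ] [μ.Regular] [μ.IsMulRightInvariant]
  {𝓕 : Set G} (h𝓕 : IsFundamentalDomain Γ.op 𝓕 μ) (hfin : μ 𝓕 ≠ ⊤)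

include hΓ h𝓕 hfin in
/-- **`[SETUP D7] sm_cont` for Haar measure.**  With `X = G ⧸ Γ` compact, `Γ` discrete countable closed, `μ` a regular
Haar measure on the unimodular `G`, and `𝓕` a fundamental domain of finite measure: for `ν = map π (μ|𝓕)` and every
sequence `f n ∈ C_c(G)`, each `R(f n) v` (`v ∈ L²(X, ν)`) is the class of a continuous function on `X`.  All instance
hypotheses of `sm_cont_model` are discharged (`haveI`) from these data. -/
theorem sm_cont_haar (fs : ℕ → G → ℝ) (hc : ∀ n, Continuous (fs n)) (hs : ∀ n, HasCompactSupport (fs n)) :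
    haveI := hΓ
    haveI := smulInvariantMeasure_map_restrict μ h𝓕
    haveI := isFiniteMeasure_map_restrict (Γ := Γ) μ hfin
    haveI := innerRegularCompactLTTop_map_restrict (Γ := Γ) μ 𝓕
    ∀ (n : ℕ) (v : Lp ℂ 2 (Measure.map (QuotientGroup.mk : G → G ⧸ Γ) (μ.restrict 𝓕))), ∃ x : C(G ⧸ Γ, ℂ),
      ContinuousMap.toLp (E := ℂ) 2 (Measure.map (QuotientGroup.mk : G → G ⧸ Γ) (μ.restrict 𝓕)) ℂ x
        = smOpX (Measure.map (QuotientGroup.mk : G → G ⧸ Γ) (μ.restrict 𝓕)) μ (fs n) (hc n) (hs n) v := by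
  haveI := hΓ
  haveI := smulInvariantMeasure_map_restrict μ h𝓕
  haveI := isFiniteMeasure_map_restrict (Γ := Γ) μ hfin
  haveI := innerRegularCompactLTTop_map_restrict (Γ := Γ) μ 𝓕
  haveI := isInvInvariant_of_isMulRightInvariant μ
  exact sm_cont_model _ μ hΓ h𝓕 rfl fs hc hs

include hΓ h𝓕 in
/-- `sm_cont_haar` with the finiteness of the covolume derived from compactness of `G ⧸ Γ`
(`measure_fundamentalDomain_lt_top`): the hypotheses are now only the data of D3/D7. -/
theorem sm_cont_haar' (fs : ℕ → G → ℝ) (hc : ∀ n, Continuous (fs n)) (hs : ∀ n, HasCompactSupport (fs n)) :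
    haveI := hΓ
    haveI := smulInvariantMeasure_map_restrict μ h𝓕
    haveI := isFiniteMeasure_map_restrict (Γ := Γ) μ (measure_fundamentalDomain_lt_top μ h𝓕).ne
    haveI := innerRegularCompactLTTop_map_restrict (Γ := Γ) μ 𝓕
    ∀ (n : ℕ) (v : Lp ℂ 2 (Measure.map (QuotientGroup.mk : G → G ⧸ Γ) (μ.restrict 𝓕))), ∃ x : C(G ⧸ Γ, ℂ),
      ContinuousMap.toLp (E := ℂ) 2 (Measure.map (QuotientGroup.mk : G → G ⧸ Γ) (μ.restrict 𝓕)) ℂ x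
        = smOpX (Measure.map (QuotientGroup.mk : G → G ⧸ Γ) (μ.restrict 𝓕)) μ (fs n) (hc n) (hs n) v :=
  sm_cont_haar hΓ μ h𝓕 (measure_fundamentalDomain_lt_top μ h𝓕).ne fs hc hs

end Haar

end QuotientSmoothing
end PerL34
end HodgeCM

end
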